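import Summits.AtomisticToContinuum.Crystallization.Theorems.ChartedZeroExcessLayeredLatticeLiouvilleZN

/-!
# Part ZNA «Parallel registration: partners, transfer, hexagons» (lens-2 g79, NODE 79 — part 2b)

Continuation of part ZN (namespace `ParCfg`, data `ParCfg`, hypotheses `ParCfg.Hyp`):

* ZN-2 THE PARTNER MAP `ptn` (the unique crystal site within `ε`), partners of REGISTERED atoms (`RegAt`: `r + q < d < ℓ − q`) lie in layer `σ(sheet)`;
  partner distances: bonded ⇒ `(0, βC]`, distinct non-bonded ⇒ `> 28/25` (door gap `(17/16·aHi, 6/5]` + crystal gap).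
* ZN-3 ★ THE TRANSFER LEMMA (`Hyp.transfer`): at a GOOD atom (`W₁ ≤ d ≤ W₂`) every crystal site within `28/25` of its partner is the partner of a
  Barlow neighbour — the exact chart of `S` is transported to `C` through the registration.
* ZN-4 ★ SHORT VECTORS (`Hyp.sv_at`): every non-zero in-sheet lattice vector of length `≤ 28/25` is, at every good atom, one of the six partner
  differences `nv x j`; these six satisfy the hypotheses of the hexagon lemma (part ZM), hence `nv x = latVec (nv x 0) (nv x 1) ∘ loDir` (`Hyp.nv_hex`).
* ZN-5 a good atom exists (`Hyp.exists_good`: walk along a Löschian row from a container atom; discrete intermediate values).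

0 sorry; standard axioms.
-/

noncomputable section
open scoped BigOperators Classical InnerProductSpace RealInnerProductSpace
open MeasureTheory Set Metric Filter Topology
open Summit.AtomisticToContinuum.Crystallization.Theorems.ChartedPlanarOrderRigidityDoor (E3 IsClean IsCharted)
open Summit.AtomisticToContinuum.Crystallization.Theorems.ChartedPlanarOrderDensityDichotomy (μS IsSep)
open Summit.AtomisticToContinuum.Crystallization.Theorems.ChartedPlanarOrderCleanScaleP (IsCleanP IsDoorSetP isCleanP_one_iff isCleanP_μS_iff)
open Summit.AtomisticToContinuum.Crystallization.Theorems.ChartedPlanarOrderMesoCut (LayeredHom EnvClose)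
open Summit.AtomisticToContinuum.Crystallization.Theorems.ChartedPlanarOrderDoorLayeredOsc (IsTwoShellAffineGood mem_iff_μS_singleton_ne_zero)
open Literature.MathematicalPhysics.StatisticalMechanics (lennardJones triangularVec₁ triangularVec₂)
open Literature.Geometry.DiscreteGeometry (IsTwoShellGoodSet)

namespace Summit.AtomisticToContinuum.Crystallization.Theorems.ChartedZeroExcessLayeredLatticeLiouville

namespace ParCfg

variable {G : ParCfg}

/-! ### ZN-2  Partners -/

/-- two crystal sites within `ε` of one point coincide (`2ε < σC`). [formal bookkeeping] -/
theorem Hyp.C_eq_of_near (hG : G.Hyp) {p c c' : E3} (hc : c ∈ G.C) (hc' : c' ∈ G.C) (h : dist p c ≤ G.ε) (h' : dist p c' ≤ G.ε) : c = c' := by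
  by_contra hne
  have := hG.sep c hc c' hc' hne
  linarith [dist_triangle_left c c' p, hG.e3]

/-- the partner of a registered point. [formal bookkeeping] -/
theorem ptn_spec (G : ParCfg) {p : E3} (h : ∃ c ∈ G.C, dist p c ≤ G.ε) : G.ptn p ∈ G.C ∧ dist p (G.ptn p) ≤ G.ε := by
  simp only [ptn, dif_pos h]
  exact h.choose_spec

/-- the partner is the crystal site within `ε`. [formal bookkeeping] -/
theorem Hyp.ptn_eq (hG : G.Hyp) {p c : E3} (hc : c ∈ G.C) (h : dist p c ≤ G.ε) : G.ptn p = c :=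
  have hs := G.ptn_spec ⟨c, hc, h⟩
  hG.C_eq_of_near hs.1 hc hs.2 h

/-- registered chart points have partners. [formal bookkeeping] -/
theorem Hyp.ptn_reg (hG : G.Hyp) {x : ℤ × ℤ × ℤ} (hx : G.RegAt x) : G.ptn (G.Ψ x) ∈ G.C ∧ dist (G.Ψ x) (G.ptn (G.Ψ x)) ≤ G.ε :=
  G.ptn_spec (hG.exists_C (hG.Ψ_mem x) hx.1 hx.2)

/-- PARALLEL REGISTRATION: skeleton representatives near a registered chart point of sheet `s` have layer index `σ s`. [formal bookkeeping] -/
theorem Hyp.fst_eq_of_near (hG : G.Hyp) {x : ℤ × ℤ × ℤ} (hx : G.RegAt x) {y : ℤ × ℤ × ℤ} (hy : dist (G.Ψ x) (G.skel y) ≤ G.ε) : y.1 = G.σ x.1 :=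
  hG.par x (hG.mem_moat (hG.Ψ_mem x) hx.1 hx.2) y hy

/-- a layer containing a site near a registered chart point of sheet `s` has index `σ s`. [formal bookkeeping] -/
theorem Hyp.eq_σ_of_near_layer (hG : G.Hyp) {x : ℤ × ℤ × ℤ} (hx : G.RegAt x) {m : ℤ} {c : E3} (hc : c ∈ G.layer m)
    (h : dist (G.Ψ x) c ≤ G.ε) : m = G.σ x.1 := by
  obtain ⟨p, hp⟩ := G.exists_skel_of_layer hc
  rw [hp] at h
  exact hG.fst_eq_of_near hx h

/-- the partner of a registered chart point of sheet `s` lies in layer `σ s`. [formal bookkeeping] -/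
theorem Hyp.ptn_layer (hG : G.Hyp) {x : ℤ × ℤ × ℤ} (hx : G.RegAt x) : G.ptn (G.Ψ x) ∈ G.layer (G.σ x.1) := by
  obtain ⟨⟨y, hy⟩, hd⟩ := hG.ptn_reg hx
  have h1 : y.1 = G.σ x.1 := hG.fst_eq_of_near hx (by rw [hy]; exact hd)
  rw [← hy, ← h1]
  exact G.skel_mem_layer y

/-- partner distances follow atom distances up to `2ε`. [formal bookkeeping] -/
theorem Hyp.dist_ptn_ptn (hG : G.Hyp) {x y : ℤ × ℤ × ℤ} (hx : G.RegAt x) (hy : G.RegAt y) :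
    dist (G.ptn (G.Ψ x)) (G.ptn (G.Ψ y)) ≤ dist (G.Ψ x) (G.Ψ y) + 2 * G.ε ∧
      dist (G.Ψ x) (G.Ψ y) ≤ dist (G.ptn (G.Ψ x)) (G.ptn (G.Ψ y)) + 2 * G.ε := by
  have h1 := (hG.ptn_reg hx).2
  have h2 := (hG.ptn_reg hy).2
  constructor
  · linarith [dist_triangle4 (G.ptn (G.Ψ x)) (G.Ψ x) (G.Ψ y) (G.ptn (G.Ψ y)), dist_comm (G.ptn (G.Ψ x)) (G.Ψ x)]
  · linarith [dist_triangle4 (G.Ψ x) (G.ptn (G.Ψ x)) (G.ptn (G.Ψ y)) (G.Ψ y), dist_comm (G.ptn (G.Ψ y)) (G.Ψ y)]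

/-- distinct registered chart points have distinct partners. [formal bookkeeping] -/
theorem Hyp.ptn_ne (hG : G.Hyp) {x y : ℤ × ℤ × ℤ} (hx : G.RegAt x) (hy : G.RegAt y) (hne : x ≠ y) : G.ptn (G.Ψ x) ≠ G.ptn (G.Ψ y) := by
  intro h
  have hS := hG.sepS _ (hG.Ψ_mem x) _ (hG.Ψ_mem y) (fun e => hne (hG.Ψ_inj e))
  have h2 := (hG.dist_ptn_ptn hx hy).2
  rw [h, dist_self] at h2
  linarith [hG.e1]

/-- ★ partners of Barlow neighbours are at distance in `(0, βC]`. [this file] -/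
theorem Hyp.ptn_bond (hG : G.Hyp) {x y : ℤ × ℤ × ℤ} (hx : G.RegAt x) (hy : G.RegAt y) (hb : BarlowAdj G.τ x y) :
    0 < dist (G.ptn (G.Ψ x)) (G.ptn (G.Ψ y)) ∧ dist (G.ptn (G.Ψ x)) (G.ptn (G.Ψ y)) ≤ G.βC := by
  have hd := hG.dist_bond hb
  have hne : x ≠ y := fun e => by rw [e, dist_self] at hd; exact lt_irrefl _ hd.1
  refine ⟨dist_pos.2 (hG.ptn_ne hx hy hne), hG.gap _ (hG.ptn_reg hx).1 _ (hG.ptn_reg hy).1 ?_⟩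
  linarith [(hG.dist_ptn_ptn hx hy).1, hG.e1]

/-- ★ partners of distinct non-neighbours are at distance `> 28/25`. [this file] -/
theorem Hyp.ptn_far (hG : G.Hyp) {x y : ℤ × ℤ × ℤ} (hx : G.RegAt x) (hy : G.RegAt y) (hne : x ≠ y) (hnb : ¬ BarlowAdj G.τ x y) :
    28 / 25 < dist (G.ptn (G.Ψ x)) (G.ptn (G.Ψ y)) := by
  linarith [(hG.dist_ptn_ptn hx hy).2, hG.dist_far hne hnb, hG.e1]

/-! ### ZN-3  Good atoms and the transfer lemma -/

/-- good chart points are registered. [formal bookkeeping] -/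
theorem Hyp.reg_of_good (hG : G.Hyp) {x : ℤ × ℤ × ℤ} (hx : G.Good x) : G.RegAt x :=
  ⟨by linarith [hx.1, hG.z1], by linarith [hx.2, hG.z6]⟩

/-- Barlow neighbours of good chart points are registered. [formal bookkeeping] -/
theorem Hyp.reg_of_adj (hG : G.Hyp) {x y : ℤ × ℤ × ℤ} (hx : G.Good x) (hb : BarlowAdj G.τ x y) : G.RegAt y := by
  have hd := (hG.dist_bond hb).2
  have h1 := dist_triangle (G.Ψ x) (G.Ψ y) G.x₀
  have h2 := dist_triangle (G.Ψ y) (G.Ψ x) G.x₀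
  rw [dist_comm (G.Ψ y) (G.Ψ x)] at h2
  exact ⟨by linarith [hx.1, hG.z1], by linarith [hx.2, hG.z6]⟩

/-- ★★ **THE TRANSFER LEMMA.**  At a good chart point `x`, every crystal site at distance in `(0, 28/25]` from the partner of `Ψ x` is the partner of a
Barlow neighbour of `x`: the site is within `βC` (crystal gap), lies in the registration zone, its registered atom is within `βC + 2ε ≤ 28/25` of
`Ψ x`, hence is `Ψ x` (excluded: the two sites would coincide) or bonded to it — and the chart of `S` is exact. [this file] -/
theorem Hyp.transfer (hG : G.Hyp) {x : ℤ × ℤ × ℤ} (hx : G.Good x) {c' : E3} (hc' : c' ∈ G.C) (h0 : 0 < dist (G.ptn (G.Ψ x)) c')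
    (h1 : dist (G.ptn (G.Ψ x)) c' ≤ 28 / 25) : ∃ y, BarlowAdj G.τ x y ∧ G.ptn (G.Ψ y) = c' := by
  have hxr := hG.reg_of_good hx
  obtain ⟨hpC, hpd⟩ := hG.ptn_reg hxr
  have hβ := hG.gap _ hpC _ hc' h1
  have t1 : dist (G.Ψ x) c' ≤ G.ε + G.βC := by linarith [dist_triangle (G.Ψ x) (G.ptn (G.Ψ x)) c']
  have hlo : G.rI + G.q < dist c' G.x₀ := by
    linarith [dist_triangle (G.Ψ x) c' G.x₀, hx.1, hG.z2]
  have hhi : dist c' G.x₀ + G.q < G.ℓ := by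
    linarith [dist_triangle c' (G.Ψ x) G.x₀, dist_comm c' (G.Ψ x), hx.2, hG.z7]
  obtain ⟨a, ha, hac⟩ := hG.exists_S hc' hlo hhi
  obtain ⟨y, rfl⟩ := hG.surj a ha
  have hxy : dist (G.Ψ x) (G.Ψ y) ≤ 28 / 25 := by
    linarith [dist_triangle (G.Ψ x) c' (G.Ψ y), dist_comm c' (G.Ψ y), hG.e4]
  by_cases hne : x = y
  · exfalso
    subst hne
    have : G.ptn (G.Ψ x) = c' := hG.ptn_eq hc' hac
    rw [this, dist_self] at h0
    exact lt_irrefl _ h0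
  · have hb : BarlowAdj G.τ x y := (hG.bond_iff x y).1 ⟨dist_pos.2 (fun e => hne (hG.Ψ_inj e)), hxy⟩
    exact ⟨y, hb, hG.ptn_eq hc' hac⟩

/-! ### ZN-4  Short vectors and hexagons at good atoms -/

/-- the Löschian neighbour in direction `j`. [formal bookkeeping] -/
theorem adj_loDir (τ : ℤ → Bool) (x : ℤ × ℤ × ℤ) (j : Fin 6) : BarlowAdj τ x (x.1, x.2 + loDir j) := Or.inl ⟨rfl, j, rfl⟩

/-- distinct directions give distinct neighbours. [formal bookkeeping] -/
theorem nbr_ne (x : ℤ × ℤ × ℤ) {i j : Fin 6} (h : i ≠ j) : (x.1, x.2 + loDir i) ≠ (x.1, x.2 + loDir j) :=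
  fun e => h (loDir_injective (add_left_cancel (Prod.mk.inj e).2))

/-- ★★ **SHORT VECTORS.**  At a good chart point `x`, every non-zero lattice vector `v` of length `≤ 28/25` is one of the six partner differences `nv x j`:
`ptn (Ψ x) + v` is a crystal site of the same layer, so (transfer) the partner of a Barlow neighbour `y`, and `y` lies in the sheet of `x` by the
parallel registration and injectivity of `σ`, i.e. `y = (x.1, x.2 + loDir j)`. [this file] -/
theorem Hyp.sv_at (hG : G.Hyp) {x : ℤ × ℤ × ℤ} (hx : G.Good x) {v : E3} (hv : G.IsLat v) (h0 : v ≠ 0) (h1 : ‖v‖ ≤ 28 / 25) :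
    ∃ j : Fin 6, v = G.nv x j := by
  have hxr := hG.reg_of_good hx
  have hc' : G.ptn (G.Ψ x) + v ∈ G.layer (G.σ x.1) := G.layer_add (hG.ptn_layer hxr) hv
  have hd : dist (G.ptn (G.Ψ x)) (G.ptn (G.Ψ x) + v) = ‖v‖ := by rw [dist_eq_norm, sub_add_cancel_left, norm_neg]
  obtain ⟨y, hb, hy⟩ := hG.transfer hx (G.layer_sub hc') (by rw [hd]; exact norm_pos_iff.2 h0) (by rw [hd]; exact h1)
  have hyr := hG.reg_of_adj hx hb
  have h1' : y.1 = x.1 := (hG.σinj (hG.eq_σ_of_near_layer hyr hc' (by rw [← hy]; exact (hG.ptn_reg hyr).2))).symm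
  have hlo : LoAdj x.2 y.2 := by
    rcases hb with ⟨-, h⟩ | ⟨h, -⟩ | ⟨h, -⟩
    · exact h
    · omega
    · omega
  obtain ⟨j, hj⟩ := hlo
  refine ⟨j, ?_⟩
  have : y = (x.1, x.2 + loDir j) := Prod.ext h1' hj
  rw [nv, ← this, hy, add_sub_cancel_left]

/-- neighbours of good chart points in the six directions are registered. [formal bookkeeping] -/
theorem Hyp.reg_nbr (hG : G.Hyp) {x : ℤ × ℤ × ℤ} (hx : G.Good x) (j : Fin 6) : G.RegAt (x.1, x.2 + loDir j) :=
  hG.reg_of_adj hx (adj_loDir _ x j)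

/-- the partner differences are lattice vectors. [formal bookkeeping] -/
theorem Hyp.nv_isLat (hG : G.Hyp) {x : ℤ × ℤ × ℤ} (hx : G.Good x) (j : Fin 6) : G.IsLat (G.nv x j) :=
  G.isLat_of_layer (hG.ptn_layer (hG.reg_of_good hx)) (hG.ptn_layer (hG.reg_nbr hx j))

/-- their lengths lie in `[σC, βC]`. [formal bookkeeping] -/
theorem Hyp.norm_nv (hG : G.Hyp) {x : ℤ × ℤ × ℤ} (hx : G.Good x) (j : Fin 6) : G.σC ≤ ‖G.nv x j‖ ∧ ‖G.nv x j‖ ≤ G.βC := by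
  have hb := hG.ptn_bond (hG.reg_of_good hx) (hG.reg_nbr hx j) (adj_loDir _ x j)
  rw [nv, ← dist_eq_norm, dist_comm]
  refine ⟨hG.sep _ (hG.ptn_reg (hG.reg_of_good hx)).1 _ (hG.ptn_reg (hG.reg_nbr hx j)).1 (dist_pos.1 hb.1), hb.2⟩

/-- differences of distinct partner differences have length `≥ σC`. [formal bookkeeping] -/
theorem Hyp.norm_nv_sub (hG : G.Hyp) {x : ℤ × ℤ × ℤ} (hx : G.Good x) {i j : Fin 6} (h : i ≠ j) : G.σC ≤ ‖G.nv x i - G.nv x j‖ := by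
  have : G.nv x i - G.nv x j = G.ptn (G.Ψ (x.1, x.2 + loDir i)) - G.ptn (G.Ψ (x.1, x.2 + loDir j)) := by simp only [nv]; abel
  rw [this, ← dist_eq_norm]
  exact hG.sep _ (hG.ptn_reg (hG.reg_nbr hx i)).1 _ (hG.ptn_reg (hG.reg_nbr hx j)).1 (hG.ptn_ne (hG.reg_nbr hx i) (hG.reg_nbr hx j) (nbr_ne x h))

/-- successive partner differences are within `βC`. [formal bookkeeping] -/
theorem Hyp.nv_adj (hG : G.Hyp) {x : ℤ × ℤ × ℤ} (hx : G.Good x) (i : Fin 6) : ‖G.nv x i - G.nv x (i + 1)‖ ≤ G.βC := by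
  have : G.nv x i - G.nv x (i + 1) = G.ptn (G.Ψ (x.1, x.2 + loDir i)) - G.ptn (G.Ψ (x.1, x.2 + loDir (i + 1))) := by simp only [nv]; abel
  rw [this, ← dist_eq_norm]
  exact (hG.ptn_bond (hG.reg_nbr hx i) (hG.reg_nbr hx (i + 1)) (Or.inl ⟨rfl, i + 2, by rw [loDir_succ_eq, add_assoc]⟩)).2

/-- non-adjacent distinct partner differences are farther than `βC`. [formal bookkeeping] -/
theorem Hyp.nv_far (hG : G.Hyp) {x : ℤ × ℤ × ℤ} (hx : G.Good x) (i j : Fin 6) (hij : i ≠ j) (hna : ¬ CycAdj i j) : G.βC < ‖G.nv x i - G.nv x j‖ := by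
  have : G.nv x i - G.nv x j = G.ptn (G.Ψ (x.1, x.2 + loDir i)) - G.ptn (G.Ψ (x.1, x.2 + loDir j)) := by simp only [nv]; abel
  rw [this, ← dist_eq_norm]
  have hnb : ¬ BarlowAdj G.τ (x.1, x.2 + loDir i) (x.1, x.2 + loDir j) := by
    rintro (⟨-, k, hk⟩ | ⟨h, -⟩ | ⟨h, -⟩)
    · have hk' : loDir j = loDir i + loDir k := add_left_cancel (by rw [← add_assoc]; exact hk)
      exact hna ((loAdj_loDir_iff i j).1 ⟨k, hk'⟩)
    · simp at h
    · simp at h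
  linarith [hG.ptn_far (hG.reg_nbr hx i) (hG.reg_nbr hx j) (nbr_ne x hij) hnb, hG.e4, hG.ε0]

/-- the six partner differences are pairwise distinct. [formal bookkeeping] -/
theorem Hyp.nv_inj (hG : G.Hyp) {x : ℤ × ℤ × ℤ} (hx : G.Good x) : Function.Injective (G.nv x) := by
  intro i j h
  by_contra hij
  have := hG.norm_nv_sub hx hij
  rw [h, sub_self, norm_zero] at this
  linarith [hG.σC_pos]

/-- they are closed under negation. [formal bookkeeping] -/
theorem Hyp.nv_neg (hG : G.Hyp) {x : ℤ × ℤ × ℤ} (hx : G.Good x) (i : Fin 6) : ∃ j, G.nv x j = -G.nv x i := by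
  have hn := hG.norm_nv hx i
  have h0 : G.nv x i ≠ 0 := fun h => by rw [h, norm_zero] at hn; linarith [hG.σC_pos]
  obtain ⟨j, hj⟩ := hG.sv_at hx (G.isLat_neg (hG.nv_isLat hx i)) (neg_ne_zero.2 h0) (by rw [norm_neg]; linarith [hG.e4, hG.ε0])
  exact ⟨j, hj.symm⟩

/-- and under successive differences. [formal bookkeeping] -/
theorem Hyp.nv_dif (hG : G.Hyp) {x : ℤ × ℤ × ℤ} (hx : G.Good x) (i : Fin 6) : ∃ j, G.nv x j = G.nv x (i + 1) - G.nv x i := by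
  have h0 : G.nv x (i + 1) - G.nv x i ≠ 0 := sub_ne_zero.2 (fun h => (fin6_aux i).1 ((hG.nv_inj hx) h).symm)
  obtain ⟨j, hj⟩ := hG.sv_at hx (G.isLat_sub (hG.nv_isLat hx (i + 1)) (hG.nv_isLat hx i)) h0
    (by rw [norm_sub_rev]; linarith [hG.nv_adj hx i, hG.e4, hG.ε0])
  exact ⟨j, hj.symm⟩

/-- ★★ **THE HEXAGON AT A GOOD ATOM**: the six partner differences ARE the Löschian hexagon on the first two (hexagon lemma, part ZM). [this file] -/
theorem Hyp.nv_hex (hG : G.Hyp) {x : ℤ × ℤ × ℤ} (hx : G.Good x) (k : Fin 6) : G.nv x k = latVec (G.nv x 0) (G.nv x 1) (loDir k) :=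
  hexagon_latVec (hexagon_vectors hG.σC_pos hG.e5 (fun i => (hG.norm_nv hx i).1) (fun i => (hG.norm_nv hx i).2) (hG.nv_adj hx)
    (hG.nv_far hx) (hG.nv_inj hx) (hG.nv_neg hx) (hG.nv_dif hx)) k

/-! ### ZN-5  A good atom exists -/

/-- ★ a good chart point exists: walk from a container atom along a Löschian row — bonded steps `≤ 17/16 ≤ 28/25`, injective hence unbounded
(`S` is separated), so the distance to `x₀` crosses `W₁` with overshoot `< 28/25 ≤ W₂ − W₁`. [this file] -/
theorem Hyp.exists_good (hG : G.Hyp) : ∃ x, G.Good x := by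
  obtain ⟨k₀, hk₀⟩ := hG.Kne
  obtain ⟨x, hx⟩ := hG.surj k₀ (hG.KS hk₀)
  set g : ℕ → E3 := fun n => G.Ψ (x.1, x.2 + (n : ℤ) • loDir 0) with hgdef
  have hadj : ∀ n : ℕ, BarlowAdj G.τ (x.1, x.2 + (n : ℤ) • loDir 0) (x.1, x.2 + ((n + 1 : ℕ) : ℤ) • loDir 0) :=
    fun n => Or.inl ⟨rfl, 0, by push_cast; rw [add_smul, one_smul, add_assoc]⟩
  have hstep : ∀ n, dist (g (n + 1)) G.x₀ ≤ dist (g n) G.x₀ + 28 / 25 := fun n => by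
    have := (hG.dist_bond (hadj n)).2
    linarith [dist_triangle (g (n + 1)) (g n) G.x₀, dist_comm (g n) (g (n + 1))]
  have hsep : ∀ m n : ℕ, m ≠ n → 27 / 32 ≤ dist (g m) (g n) := by
    intro m n h
    refine hG.sepS _ (hG.Ψ_mem _) _ (hG.Ψ_mem _) (fun e => h ?_)
    have e2 := congrArg Prod.fst (add_left_cancel (Prod.mk.inj (hG.Ψ_inj e)).2)
    simp [loDir] at e2
    omega
  have h0 : dist (g 0) G.x₀ < G.W₁ := by
    have : g 0 = k₀ := by simp [hgdef, hx]
    rw [this]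
    linarith [hG.Kq k₀ hk₀, hG.z3]
  obtain ⟨n, hn⟩ := exists_far_of_sep (by norm_num) hsep G.x₀ G.W₁
  obtain ⟨n, hn1, hn2⟩ := discrete_ivt (f := fun n => dist (g n) G.x₀) h0 ⟨n, hn.le⟩ hstep
  exact ⟨(x.1, x.2 + (n : ℤ) • loDir 0), hn1, by linarith [hG.z4]⟩

end ParCfg

end Summit.AtomisticToContinuum.Crystallization.Theorems.ChartedZeroExcessLayeredLatticeLiouville
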